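import Literature.AlgebraicGeometry.Deligne1982.WeilTypeCMGeneralMemberIsogenyClass
import Literature.AlgebraicGeometry.Deligne1982.WeilTypeCMGeneralMemberEndomorphismField
import Literature.AlgebraicGeometry.VanGeemen1994.WeilTypeGeneralMemberIsogenyClass
import HarnessLib

/-!
# The endomorphism portrait of the general CM-Weil abelian variety descends to its isogeny class

Deligne [Deligne1982HodgeCycles, §4 and Milne's 2003 re-edition endnote 16], Milne [Milne2025AbelianMotivesCharP, §1.5
Example 1.17]: for a GENERAL polarized abelian variety `(B, θ, h)` of Weil type relative to a CM field `E = ℚ(θ)`,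
`[E : ℚ] = 2e₀`, `dim_E H¹(B, ℚ) = 2k` — in the tree's typing `IsWeilTypeCM B θ R e₀ k`, `IsPolarizationClass`,
`IsRosatiCM`, and «`Hg(B) = SU(φ)`» = `HasHodgeGroupSUCM B θ P_R h` — the sister file
`WeilTypeCMGeneralMemberEndomorphismField` proves (for `2k ≥ 4`) that `End⁰(B) = ℚ(θ) ≅ E` is a (CM) field of degree `2e₀`,
so that `B` is simple, of Albert type IV, and not of CM type; and `WeilTypeCMGeneralMemberIsogenyClass` proves that the four
hypotheses are transported along an isogeny `f : A ⟶ B` with `f ≫ θ = η ≫ f` to `(A, η, f^*h)`.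

## What (all `theorem`s, no new definitions, no new facts)

* §1 (the `E`-isogeny class, `f : A ⟶ B` an isogeny with `f ≫ θ = η ≫ f`, `2 ≤ k`):
  `exists_pullbackOne_eq_aeval_of_isIsogeny_of_hasHodgeGroupSUCM` (every `ψ ∈ End(A)` acts on `H¹(A(ℂ); ℂ)` as a polynomial
  in `η^*`), `comp_comm_of_isIsogeny_of_hasHodgeGroupSUCM` (`End(A)` commutative),
  `finrank_endAlgebra_eq_of_isIsogeny_of_hasHodgeGroupSUCM` (`[End⁰(A) : ℚ] = 2e₀`),
  `exists_eq_aeval_endAlgebra_of_isIsogeny_of_hasHodgeGroupSUCM` (`End⁰(A) = ℚ[η]`),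
  **`isField_endAlgebra_of_isIsogeny_of_hasHodgeGroupSUCM`** (so `A` is simple, tree `isSimple_of_isField_endAlgebra` /
  `EndFieldFullDegree.isSimple_of_special`), **`not_hasNoTypeIVFactor_of_isIsogeny_of_hasHodgeGroupSUCM`**,
  `isCMField_endField_of_isIsogeny_of_hasHodgeGroupSUCM`, **`not_isOfCMType_of_isIsogeny_of_hasHodgeGroupSUCM`**,
  `weilTypeCM_generalMember_summary_of_isIsogeny` (simple, field of degree `2e₀`, not CM, semisimple `Hg`, type IV).
* §2 (the plain isogeny class `C ∼ B`, no `E`-structure on `C` needed — simplicity, `End⁰` up to `ℚ`-algebra isomorphism,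
  CM type and «no factor of type IV» are isogeny invariants in the tree):
  **`isSimple_of_isIsogenous_of_hasHodgeGroupSUCM`**, **`isField_endAlgebra_of_isIsogenous_of_hasHodgeGroupSUCM`**
  (`End⁰(C)` a field of degree `2e₀`), `endAlgebra_mul_comm_of_isIsogenous_of_hasHodgeGroupSUCM`,
  `comp_comm_of_isIsogenous_of_hasHodgeGroupSUCM`, **`not_isOfCMType_of_isIsogenous_of_hasHodgeGroupSUCM`**,
  **`not_hasNoTypeIVFactor_of_isIsogenous_of_hasHodgeGroupSUCM`**, `isCMField_endField_of_isIsogenous_of_hasHodgeGroupSUCM`,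
  `not_hasNoTypeIVFactor_powSucc_of_hasHodgeGroupSUCM`, `not_hasNoTypeIVFactor_of_isIsogenous_powSucc_of_hasHodgeGroupSUCM`,
  `not_isOfCMType_powSucc_of_hasHodgeGroupSUCM`, **`weilTypeCM_isogenyClass_summary`**.

## Why (users)

The CM-field companion of `VanGeemen1994/WeilTypeGeneralMemberIsogenyClass` §3 (imaginary quadratic `K`): the Track-2
reductions treat Weil-type abelian varieties up to isogeny, and the type-IV / not-CM / simple branch tests
(`HasNoTypeIVFactor`, `Milne1999.IsOfCMType`, `AbelianVariety.IsSimple`) are now available on the whole isogeny class of a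
general CM-Weil abelian variety and on its powers.

## How

§1: `weilTypeCM_generalMember_portrait_of_isIsogeny` transports the four hypotheses to `(A, η, f^*h)` (the invariant `k` is
unchanged), and the theorems of `WeilTypeCMGeneralMemberEndomorphismField` apply to `A` verbatim. §2: the tree's isogeny
invariance of simplicity (`AbelianVariety.isSimple_iff_of_isIsogenous`), of `End⁰` (`IsIsogenous.nonempty_endAlgebra_algEquiv`),
of CM type (`isOfCMType_iff_of_isIsogenous`) and of `HasNoTypeIVFactor` (`HasNoTypeIVFactor.of_isIsogenous`,
`hasNoTypeIVFactor_powSucc_iff`), and faithfulness of `End(C) → End⁰(C)` (`endAlgebra.of_injective_of_charZero`).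

## References

* [Deligne1982HodgeCycles] P. Deligne, *Hodge cycles on abelian varieties*, LNM 900 (1982), §4; Milne's 2003 re-edition, endnote 16.
* [Milne2025AbelianMotivesCharP] J. S. Milne, *Abelian motives in characteristic p*, arXiv:2508.09972, §1.5 Example 1.17
  (chunk p0006 L120–L149).
* [MoonenZarhin1999LowDim] B. Moonen, Yu. Zarhin, Duke Math. J. 97 (1999), §1 (Albert types; type IV).
* [vanGeemen1994HodgeAV] B. van Geemen, in: *Algebraic Cycles and Hodge Theory*, LNM 1594 (1994), 6.9–6.12.
* [MumfordAV1970] D. Mumford, *Abelian Varieties* (1970), §19 Cor. 2 of Thm. 1, Thm. 3.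
-/

noncomputable section

open CategoryTheory Polynomial
open Literature.AlgebraicTopology.SingularHomology
open Literature.AlgebraicGeometry.Motives
open Literature.AlgebraicGeometry.HodgeTheory
open Literature.AlgebraicGeometry.VanGeemen1994
open Literature.AlgebraicGeometry.Milne1999
open Literature.AlgebraicGeometry.ComplexMultiplication

namespace Literature.AlgebraicGeometry.Deligne1982

/-! ### §1 The `E`-isogeny class of the general member -/

section EIsogenous

variable {A B : AbelianVariety ℂ} {f : A ⟶ B} {η : A ⟶ A} {θ : B ⟶ B} {R : Polynomial ℤ} {e₀ k : ℕ}
  {h : complexBetti B.X 2}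
variable (hW : IsWeilTypeCM B θ R e₀ k) (hpol : IsPolarizationClass B.dim B.X h) (hRos : IsRosatiCM B θ h)
  (hSU : HasHodgeGroupSUCM B θ (R.comp (X ^ 2)) h) (hk : 2 ≤ k) (hf : AbelianVariety.IsIsogeny f) (hcomm : f ≫ θ = η ≫ f)

include hW hpol hRos hSU hk hf hcomm

/-- **Along an `E`-equivariant isogeny `f : A ⟶ B` to a general CM-Weil `(B, θ, h)` (`2k ≥ 4`), every endomorphism of
`A` acts on `H¹(A(ℂ); ℂ)` as a polynomial in `η^*`.** [cite: Milne2025AbelianMotivesCharP, §1.5 Example 1.17]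
[cite: Deligne1982HodgeCycles, §4 and Milne 2003 re-edition endnote 16] -/
theorem exists_pullbackOne_eq_aeval_of_isIsogeny_of_hasHodgeGroupSUCM (ψ : A ⟶ A) :
    ∃ Q : ℂ[X], pullbackOne A ψ = aeval (pullbackOne A η) Q := by
  obtain ⟨hW', hpol', hRos', hSU', -, -⟩ := weilTypeCM_generalMember_portrait_of_isIsogeny hW hpol hRos hSU hf hcomm
  exact exists_pullbackOne_eq_aeval_of_hasHodgeGroupSUCM hW' hpol' hRos' hSU' hk ψ

/-- `End(A)` is commutative on the `E`-isogeny class of the general member. [cite: Milne2025AbelianMotivesCharP, §1.5 Example 1.17] -/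
theorem comp_comm_of_isIsogeny_of_hasHodgeGroupSUCM (φ' ψ : A ⟶ A) : φ' ≫ ψ = ψ ≫ φ' := by
  obtain ⟨hW', hpol', hRos', hSU', -, -⟩ := weilTypeCM_generalMember_portrait_of_isIsogeny hW hpol hRos hSU hf hcomm
  exact comp_comm_of_hasHodgeGroupSUCM hW' hpol' hRos' hSU' hk φ' ψ

/-- **`[End⁰(A) : ℚ] = 2e₀ = [E : ℚ]`** on the `E`-isogeny class of the general member.
[cite: Milne2025AbelianMotivesCharP, §1.5 Example 1.17] [cite: MoonenZarhin1999LowDim, §1] -/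
theorem finrank_endAlgebra_eq_of_isIsogeny_of_hasHodgeGroupSUCM : Module.finrank ℚ A.endAlgebra = 2 * e₀ := by
  obtain ⟨hW', hpol', hRos', hSU', -, -⟩ := weilTypeCM_generalMember_portrait_of_isIsogeny hW hpol hRos hSU hf hcomm
  exact finrank_endAlgebra_eq_of_hasHodgeGroupSUCM hW' hpol' hRos' hSU' hk

/-- **`End⁰(A) = ℚ[η]`** on the `E`-isogeny class of the general member. [cite: Milne2025AbelianMotivesCharP, §1.5 Example 1.17] -/
theorem exists_eq_aeval_endAlgebra_of_isIsogeny_of_hasHodgeGroupSUCM (x : A.endAlgebra) :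
    ∃ q : ℚ[X], x = aeval (AbelianVariety.endAlgebra.of A η) q := by
  obtain ⟨hW', hpol', hRos', hSU', -, -⟩ := weilTypeCM_generalMember_portrait_of_isIsogeny hW hpol hRos hSU hf hcomm
  exact exists_eq_aeval_endAlgebra_of_hasHodgeGroupSUCM hW' hpol' hRos' hSU' hk x

/-- **`End⁰(A) = ℚ(η) ≅ E` IS A FIELD** on the `E`-isogeny class of the general member.
[cite: Milne2025AbelianMotivesCharP, §1.5 Example 1.17] [cite: Deligne1982HodgeCycles, §4 and Milne 2003 re-edition endnote 16] -/
theorem isField_endAlgebra_of_isIsogeny_of_hasHodgeGroupSUCM : IsField A.endAlgebra := by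
  obtain ⟨hW', hpol', hRos', hSU', -, -⟩ := weilTypeCM_generalMember_portrait_of_isIsogeny hW hpol hRos hSU hf hcomm
  exact isField_endAlgebra_of_hasHodgeGroupSUCM hW' hpol' hRos' hSU' hk

/-- **`A` HAS A FACTOR OF TYPE IV** (the tree's `HasNoTypeIVFactor A` fails) on the `E`-isogeny class of the general member.
[cite: MoonenZarhin1999LowDim, §1 (type 4)] [cite: Milne2025AbelianMotivesCharP, §1.5 Example 1.17] -/
theorem not_hasNoTypeIVFactor_of_isIsogeny_of_hasHodgeGroupSUCM : ¬ HasNoTypeIVFactor A := by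
  obtain ⟨hW', hpol', hRos', hSU', -, -⟩ := weilTypeCM_generalMember_portrait_of_isIsogeny hW hpol hRos hSU hf hcomm
  exact not_hasNoTypeIVFactor_of_hasHodgeGroupSUCM hW' hpol' hRos' hSU' hk

/-- **`End⁰(A)` IS A CM FIELD** on the `E`-isogeny class of the general member. [cite: MoonenZarhin1999LowDim, §1]
[cite: Shimura1998, §5.1 Proposition 5 (p. 36)] -/
theorem isCMField_endField_of_isIsogeny_of_hasHodgeGroupSUCM :
    NumberField.IsCMField (EndField A (isField_endAlgebra_of_isIsogeny_of_hasHodgeGroupSUCM hW hpol hRos hSU hk hf hcomm)) :=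
  (not_hasNoTypeIVFactor_iff_isCMField_endField _).1
    (not_hasNoTypeIVFactor_of_isIsogeny_of_hasHodgeGroupSUCM hW hpol hRos hSU hk hf hcomm)

/-- **`A` IS NOT OF CM TYPE** on the `E`-isogeny class of the general member. [cite: Milne1999, §2 p. 54]
[cite: Milne2025AbelianMotivesCharP, §1.5 Example 1.17] -/
theorem not_isOfCMType_of_isIsogeny_of_hasHodgeGroupSUCM : ¬ Milne1999.IsOfCMType A := by
  obtain ⟨hW', hpol', hRos', hSU', -, -⟩ := weilTypeCM_generalMember_portrait_of_isIsogeny hW hpol hRos hSU hf hcomm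
  exact not_isOfCMType_of_hasHodgeGroupSUCM hW' hpol' hRos' hSU' hk

/-- **SUMMARY on the `E`-isogeny class**: `A` simple, `End⁰(A)` a field of degree `2e₀`, not of CM type, semisimple Hodge
group, a factor of type IV. [cite: Milne2025AbelianMotivesCharP, §1.5 Example 1.17]
[cite: Deligne1982HodgeCycles, §4 (4.4) and Milne 2003 re-edition endnote 16] -/
theorem weilTypeCM_generalMember_summary_of_isIsogeny :
    AbelianVariety.IsSimple A ∧ IsField A.endAlgebra ∧ Module.finrank ℚ A.endAlgebra = 2 * e₀ ∧
      ¬ Milne1999.IsOfCMType A ∧ HasSemisimpleHodgeGroup A ∧ ¬ HasNoTypeIVFactor A := by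
  obtain ⟨hW', hpol', hRos', hSU', -, -⟩ := weilTypeCM_generalMember_portrait_of_isIsogeny hW hpol hRos hSU hf hcomm
  exact weilTypeCM_generalMember_summary hW' hpol' hRos' hSU' hk

end EIsogenous

/-! ### §2 The plain isogeny class of the general member -/

section IsogenyClass

variable {B C : AbelianVariety ℂ} {θ : B ⟶ B} {R : Polynomial ℤ} {e₀ k : ℕ} {h : complexBetti B.X 2}
variable (hW : IsWeilTypeCM B θ R e₀ k) (hpol : IsPolarizationClass B.dim B.X h) (hRos : IsRosatiCM B θ h)
  (hSU : HasHodgeGroupSUCM B θ (R.comp (X ^ 2)) h) (hk : 2 ≤ k)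

include hW hpol hRos hSU hk

/-- **Every abelian variety isogenous to a general CM-Weil `(B, θ, h)` (`2k ≥ 4`) is simple** (simplicity is an isogeny
invariant, tree `AbelianVariety.isSimple_iff_of_isIsogenous`). [cite: Milne2025AbelianMotivesCharP, §1.5 Example 1.17]
[cite: MumfordAV1970, §19 Cor. 2 of Thm. 1] -/
theorem isSimple_of_isIsogenous_of_hasHodgeGroupSUCM (hC : AbelianVariety.IsIsogenous C B) : AbelianVariety.IsSimple C :=
  (AbelianVariety.isSimple_iff_of_isIsogenous hC).2 (isSimple_of_hasHodgeGroupSUCM hW hpol hRos hSU hk)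

/-- **… has `End⁰(C)` a field of degree `2e₀`** (`End⁰` is an isogeny invariant, tree
`IsIsogenous.nonempty_endAlgebra_algEquiv`). [cite: Milne2025AbelianMotivesCharP, §1.5 Example 1.17]
[cite: MumfordAV1970, §19 Cor. 1–2 of Thm. 3] -/
theorem isField_endAlgebra_of_isIsogenous_of_hasHodgeGroupSUCM (hC : AbelianVariety.IsIsogenous C B) :
    IsField C.endAlgebra ∧ Module.finrank ℚ C.endAlgebra = 2 * e₀ := by
  obtain ⟨ε⟩ := hC.nonempty_endAlgebra_algEquiv
  exact ⟨MulEquiv.isField (isField_endAlgebra_of_hasHodgeGroupSUCM hW hpol hRos hSU hk) ε.toMulEquiv,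
    ε.toLinearEquiv.finrank_eq.trans (finrank_endAlgebra_eq_of_hasHodgeGroupSUCM hW hpol hRos hSU hk)⟩

/-- … has commutative `End⁰(C)`. [cite: Milne2025AbelianMotivesCharP, §1.5 Example 1.17] -/
theorem endAlgebra_mul_comm_of_isIsogenous_of_hasHodgeGroupSUCM (hC : AbelianVariety.IsIsogenous C B)
    (x y : C.endAlgebra) : x * y = y * x :=
  (isField_endAlgebra_of_isIsogenous_of_hasHodgeGroupSUCM hW hpol hRos hSU hk hC).1.mul_comm x y

/-- … has commutative `End(C)` (`End(C) → End⁰(C)` is injective, tree `endAlgebra.of_injective_of_charZero`).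
[cite: Milne2025AbelianMotivesCharP, §1.5 Example 1.17] [cite: MumfordAV1970, §19 Thm. 3] -/
theorem comp_comm_of_isIsogenous_of_hasHodgeGroupSUCM (hC : AbelianVariety.IsIsogenous C B) (φ ψ : C ⟶ C) :
    φ ≫ ψ = ψ ≫ φ := by
  have hc := endAlgebra_mul_comm_of_isIsogenous_of_hasHodgeGroupSUCM hW hpol hRos hSU hk hC
    (AbelianVariety.endAlgebra.of C ψ) (AbelianVariety.endAlgebra.of C φ)
  rw [← map_mul, ← map_mul] at hc
  exact AbelianVariety.endAlgebra.of_injective_of_charZero (A := C) hc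

/-- **… is not of CM type** (CM type is an isogeny invariant, tree `isOfCMType_iff_of_isIsogenous`).
[cite: Milne1999, §2 p. 54] [cite: Milne2025AbelianMotivesCharP, §1.5 Example 1.17] -/
theorem not_isOfCMType_of_isIsogenous_of_hasHodgeGroupSUCM (hC : AbelianVariety.IsIsogenous C B) :
    ¬ Milne1999.IsOfCMType C := fun hCM ↦
  not_isOfCMType_of_hasHodgeGroupSUCM hW hpol hRos hSU hk ((isOfCMType_iff_of_isIsogenous hC).1 hCM)

/-- **… has a factor of type IV** (`HasNoTypeIVFactor` is an isogeny invariant, tree `HasNoTypeIVFactor.of_isIsogenous`).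
[cite: MoonenZarhin1999LowDim, §1 (type 4)] [cite: Milne2025AbelianMotivesCharP, §1.5 Example 1.17] -/
theorem not_hasNoTypeIVFactor_of_isIsogenous_of_hasHodgeGroupSUCM (hC : AbelianVariety.IsIsogenous C B) :
    ¬ HasNoTypeIVFactor C := fun h4 ↦
  not_hasNoTypeIVFactor_of_hasHodgeGroupSUCM hW hpol hRos hSU hk (h4.of_isIsogenous hC.symm')

/-- **… has `End⁰(C)` a CM field.** [cite: MoonenZarhin1999LowDim, §1] [cite: Shimura1998, §5.1 Proposition 5 (p. 36)] -/
theorem isCMField_endField_of_isIsogenous_of_hasHodgeGroupSUCM (hC : AbelianVariety.IsIsogenous C B) :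
    NumberField.IsCMField
      (EndField C (isField_endAlgebra_of_isIsogenous_of_hasHodgeGroupSUCM hW hpol hRos hSU hk hC).1) :=
  (not_hasNoTypeIVFactor_iff_isCMField_endField _).1
    (not_hasNoTypeIVFactor_of_isIsogenous_of_hasHodgeGroupSUCM hW hpol hRos hSU hk hC)

/-- **The powers `B^{N+1}` of a general CM-Weil abelian variety have a factor of type IV** (tree
`hasNoTypeIVFactor_powSucc_iff`). [cite: MoonenZarhin1999LowDim, §1] [cite: Milne2025AbelianMotivesCharP, §1.5 Example 1.17] -/
theorem not_hasNoTypeIVFactor_powSucc_of_hasHodgeGroupSUCM (N : ℕ) : ¬ HasNoTypeIVFactor (B.powSucc N) := fun h4 ↦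
  not_hasNoTypeIVFactor_of_hasHodgeGroupSUCM hW hpol hRos hSU hk ((hasNoTypeIVFactor_powSucc_iff N).1 h4)

/-- … and so does every abelian variety isogenous to a power `B^{N+1}`. [cite: MoonenZarhin1999LowDim, §1]
[cite: Milne2025AbelianMotivesCharP, §1.5 Example 1.17] -/
theorem not_hasNoTypeIVFactor_of_isIsogenous_powSucc_of_hasHodgeGroupSUCM {N : ℕ}
    (hC : AbelianVariety.IsIsogenous C (B.powSucc N)) : ¬ HasNoTypeIVFactor C := fun h4 ↦
  not_hasNoTypeIVFactor_powSucc_of_hasHodgeGroupSUCM hW hpol hRos hSU hk N (h4.of_isIsogenous hC.symm')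

/-- **The powers `B^{N+1}` of a general CM-Weil abelian variety are not of CM type** (tree `isOfCMType_powSucc_iff`).
[cite: Milne1999, §2 p. 54] [cite: Milne2025AbelianMotivesCharP, §1.5 Example 1.17] -/
theorem not_isOfCMType_powSucc_of_hasHodgeGroupSUCM (N : ℕ) : ¬ Milne1999.IsOfCMType (B.powSucc N) := fun hCM ↦
  not_isOfCMType_of_hasHodgeGroupSUCM hW hpol hRos hSU hk ((isOfCMType_powSucc_iff N).1 hCM)

/-- **SUMMARY — THE ISOGENY CLASS OF A GENERAL CM-WEIL ABELIAN VARIETY (`Hg = SU(φ)`, `2k ≥ 4`)**: every `C ∼ B` is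
simple, with `End⁰(C)` a field of degree `2e₀`, not of CM type, with semisimple Hodge group (sister file
`hasSemisimpleHodgeGroup_of_isIsogenous_of_hasHodgeGroupSUCM`) and a factor of type IV.
[cite: Milne2025AbelianMotivesCharP, §1.5 Example 1.17] [cite: Deligne1982HodgeCycles, §4 (4.4) and Milne 2003 re-edition endnote 16]
[cite: MoonenZarhin1999LowDim, §1] -/
theorem weilTypeCM_isogenyClass_summary (hC : AbelianVariety.IsIsogenous C B) :
    AbelianVariety.IsSimple C ∧ IsField C.endAlgebra ∧ Module.finrank ℚ C.endAlgebra = 2 * e₀ ∧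
      ¬ Milne1999.IsOfCMType C ∧ HasSemisimpleHodgeGroup C ∧ ¬ HasNoTypeIVFactor C :=
  ⟨isSimple_of_isIsogenous_of_hasHodgeGroupSUCM hW hpol hRos hSU hk hC,
    (isField_endAlgebra_of_isIsogenous_of_hasHodgeGroupSUCM hW hpol hRos hSU hk hC).1,
    (isField_endAlgebra_of_isIsogenous_of_hasHodgeGroupSUCM hW hpol hRos hSU hk hC).2,
    not_isOfCMType_of_isIsogenous_of_hasHodgeGroupSUCM hW hpol hRos hSU hk hC,
    hasSemisimpleHodgeGroup_of_isIsogenous_of_hasHodgeGroupSUCM hW hpol hRos hSU hC,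
    not_hasNoTypeIVFactor_of_isIsogenous_of_hasHodgeGroupSUCM hW hpol hRos hSU hk hC⟩

end IsogenyClass

end Literature.AlgebraicGeometry.Deligne1982

end
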